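import Mathlib.Algebra.Polynomial.Splits
import Mathlib.Algebra.Polynomial.Bivariate
import Mathlib.Algebra.Polynomial.Taylor
import Mathlib.RingTheory.LaurentSeries
import Mathlib.RingTheory.HahnSeries.PowerSeries
import Mathlib.RingTheory.Polynomial.ScaleRoots
import Mathlib.Analysis.SpecialFunctions.Pow.Real
import Mathlib.RingTheory.Henselian
import Mathlib.RingTheory.AdicCompletion.Completeness
import Mathlib.FieldTheory.KummerExtension
import Mathlib.RingTheory.RootsOfUnity.Complex
import Mathlib.FieldTheory.IsAlgClosed.Basic
import Mathlib.Analysis.Complex.Polynomial.Basic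
import HarnessLib

/-!
# Belyi integrands (dessin triples read on `(0,1)`)

A *Belyi map* is a finite morphism of curves `β : X → ℙ¹` unramified outside `{0, 1, ∞}`
[cite: SijslingVoight2015, §1]; by Belyi's theorem [Belyi1980] every curve over `ℚ̄` carries one.
Route `Summit.KontsevichZagierPeriods.KontsevichZagierPeriods.Theses.DessinsDimensionOne` (item
`BelyiNormalForm`, `stmt-KontsevichZagierPeriods-6267`) reads the one-dimensional part of the
Kontsevich–Zagier calculus of periods [KontsevichZagier2001, §1.1–1.2] through dessins: after
Belyi's algorithm every one-dimensional integral representation becomes a `ℤ`-combination of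
`∫₀¹ h_j(t) dt` whose integrands `h_j` are **Belyi integrands** — real branches on `(0,1)` of
algebraic functions over `ℚ` whose analytic continuation is unramified outside `{0, 1, ∞}`
("`h dt = (β|_e)_* ω` for a dessin `(X, β)` over `ℚ`, a rational `1`-form `ω` and a real edge `e`").

This file supplies that predicate, `Literature.NumberTheory.Transcendental.IsBelyiIntegrand`,
in the elementary form the route inlines (Mathlib has no ramification theory for covers of curves
and no Puiseux series), together with a small API.

## The definition

`IsBelyiIntegrand h` (`h : ℝ → ℝ`; only the values on `(0,1)` matter): there is a nonzero
`P ∈ ℚ[t][Y]` (`Polynomial (Polynomial ℚ)`, outer variable `Y`, coefficients in `ℚ[t]`) with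

* `P(t, h t) = 0` for every `t ∈ (0,1)` (`Polynomial.evalEval`, after base change `ℚ → ℝ`), and
* for every `t₀ ∈ ℂ ∖ {0, 1}` the polynomial `P(t₀ + s, Y) ∈ ℂ((s))[Y]` splits into linear factors
  over the Laurent-series field `ℂ((s))` (`LaurentSeries ℂ = HahnSeries ℤ ℂ`): all Puiseux roots of
  `P` at `t₀` are honest Laurent series in `s = t − t₀`, i.e. every branch of the algebraic
  function `P = 0` is meromorphic at `t₀` — unramified there, poles and nodes allowed.

The coefficient map `ℚ[t] → ℂ((s))`, `t ↦ t₀ + s`, is `laurentExpansionAt t₀`; the definition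
spells it out literally (so that `isBelyiIntegrand_iff` is `Iff.rfl` and the predicate matches the
term inlined in the route, see `isBelyiIntegrand_comp_const_iff` for the `Fin 1 → ℝ` phrasing).
Nothing is required at `0`, `1`, `∞` (arbitrary ramification and growth there), and the condition is
insensitive to extra factors of `P` vanishing on the graph of `h` (divisors of split polynomials
split, `Polynomial.Splits.of_dvd`).  No continuity of `h` is built in: in the route the function is
the integrand of a `KZ.IntegralRep 1`, which carries its own semialgebraicity.

## API (all proved)

* `IsBelyiIntegrand.congr` — depends only on `h|(0,1)`;
* genus zero: `IsBelyiIntegrand.of_mul_eq_polynomial` (`q h = p` on `(0,1)`, `p, q ∈ ℚ[t]`,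
  `q ≠ 0`: every rational function over `ℚ`, poles anywhere), `isBelyiIntegrand_aeval`,
  `isBelyiIntegrand_const`;
* `ℚ(t)`-linearity: `IsBelyiIntegrand.polynomial_mul`, `.of_polynomial_mul_eq`,
  `.of_polynomial_mul_eq_polynomial_mul`, `.neg`, `.const_mul`;
* the Belyi-monoid involution `t ↦ 1 − t`: `IsBelyiIntegrand.comp_one_sub` (via
  `laurentNeg : ℂ((s)) →+* ℂ((s))`, `s ↦ −s`, and `laurentExpansionAt_comp_compRingHom_one_sub`);
* the beta family: `isBelyiIntegrand_rpow_mul_rpow` — `t ↦ t ^ a (1 − t) ^ b` is a Belyi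
  integrand for all `a b : ℚ` (the triples behind `B(a+1, b+1) = ∫₀¹ t^a (1−t)^b dt`,
  [KontsevichZagier2001, §1.1]); the proof takes `n`-th roots of `t₀ + s` and `1 − t₀ − s` in
  `ℂ⟦s⟧` by Hensel's lemma (`exists_eq_pow_of_constantCoeff_ne_zero`, from Mathlib's
  `IsAdicComplete.henselianRing`) and splits `Y^n − c` with the `n`-th roots of unity of `ℂ`.

## Not here (deliberately)

* Closure under sums and products of Belyi integrands (resultants), and push-forward along the
  degree-`2` elements `t², 4t(1−t)` of the Belyi monoid (needs substitution of series of order `2`);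
  the involutions `1/t`, `t/(t−1)` act on functions on `(1,∞)`, `(−∞,0)` and are not closure
  properties of a predicate that only sees `(0,1)`.
* The normal-form theorem itself (`BelyiNormalForm`) and Belyi's theorem — route items / facts,
  not definitions.
* Genus-`0` Belyi maps `ℙ¹ → ℙ¹` as used by the ABC summit live in
  `Literature.NumberTheory.DiophantineGeometry.HasBelyiWitness` / `IsBelyiPolynomial`
  (not imported).

## References

* [Belyi1980] G. V. Belyĭ, On Galois extensions of a maximal cyclotomic field, Math. USSR Izv. 14
  (1980) 247–256 (curves over `ℚ̄` ⇔ covers of `ℙ¹` unramified outside three points).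
* [SijslingVoight2015] J. Sijsling, J. Voight, On computing Belyi maps, Publ. Math. Besançon
  (2014/2015), §1 (definition of Belyi maps, Belyi's theorem, Lando–Zvonkin's "Belyi pairs").
* [KontsevichZagier2001] M. Kontsevich, D. Zagier, Periods (2001), §1.1–1.2.
* [HuberWustholz2022] A. Huber, G. Wüstholz, Transcendence and linear relations of 1-periods
  (2022), Ch. 12 (periods of curve type).
-/

noncomputable section

open Polynomial

namespace Literature.NumberTheory.Transcendental

/-- The *Laurent expansion at `t₀ ∈ ℂ`* of a rational one-variable polynomial: the ring map
`ℚ[t] → ℂ((s))`, `t ↦ t₀ + s`, i.e. `p ↦ p(t₀ + s)` viewed in the Laurent-series field `ℂ((s))`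
(through `ℂ[s] ⊂ ℂ⟦s⟧ ⊂ ℂ((s))`). [folklore] -/
def laurentExpansionAt (t₀ : ℂ) : ℚ[X] →+* LaurentSeries ℂ :=
  (HahnSeries.ofPowerSeries ℤ ℂ).comp
    ((Polynomial.coeToPowerSeries.ringHom (R := ℂ)).comp
      (Polynomial.eval₂RingHom (algebraMap ℚ (Polynomial ℂ)) (Polynomial.C t₀ + Polynomial.X)))

/-- **Belyi integrands** (dessin triples read on `(0,1)`).  `IsBelyiIntegrand h` says that on
`(0,1)` the real function `h` is a branch of an algebraic function over `ℚ` which is unramified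
outside `{0, 1, ∞}`: there is a nonzero `P ∈ ℚ[t][Y]` with `P(t, h(t)) = 0` for all `t ∈ (0,1)`
such that for every `t₀ ∈ ℂ ∖ {0,1}` the polynomial `P(t₀ + s, Y)` splits into linear factors over
the Laurent-series field `ℂ((s))` (every Puiseux root at `t₀` is a Laurent series in `s = t − t₀`;
poles and nodes allowed, nothing asked at `0, 1, ∞`).  Equivalently `h dt = (β|_e)_* ω` for a Belyi
pair `(X, β)` over `ℚ` — `β` unramified outside `{0,1,∞}` — a rational `1`-form `ω` on `X` and a
real edge `e ⊂ β⁻¹(0,1)`; this is the hub's packaging (route `DessinsDimensionOne`, item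
`BelyiNormalForm`) of the notion of Belyi map. Only the values of `h` on `(0,1)` matter; no
continuity is imposed. [cite: SijslingVoight2015, §1] -/
def IsBelyiIntegrand (h : ℝ → ℝ) : Prop :=
  ∃ P : Polynomial (Polynomial ℚ), P ≠ 0 ∧
    (∀ t ∈ Set.Ioo (0:ℝ) 1,
      (P.map (Polynomial.mapRingHom (algebraMap ℚ ℝ))).evalEval t (h t) = 0) ∧
    ∀ t₀ : ℂ, t₀ ≠ 0 → t₀ ≠ 1 →
      (P.map ((HahnSeries.ofPowerSeries ℤ ℂ).comp
        ((Polynomial.coeToPowerSeries.ringHom (R := ℂ)).comp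
          (Polynomial.eval₂RingHom (algebraMap ℚ (Polynomial ℂ))
            (Polynomial.C t₀ + Polynomial.X))))).Splits

/-- Unfolding of `IsBelyiIntegrand` in terms of `laurentExpansionAt` (`Iff.rfl`). [folklore] -/
theorem isBelyiIntegrand_iff (h : ℝ → ℝ) :
    IsBelyiIntegrand h ↔
      ∃ P : Polynomial (Polynomial ℚ), P ≠ 0 ∧
        (∀ t ∈ Set.Ioo (0:ℝ) 1,
          (P.map (Polynomial.mapRingHom (algebraMap ℚ ℝ))).evalEval t (h t) = 0) ∧
        ∀ t₀ : ℂ, t₀ ≠ 0 → t₀ ≠ 1 → (P.map (laurentExpansionAt t₀)).Splits :=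
  Iff.rfl

/-- `laurentExpansionAt t₀` on constants. [folklore] -/
@[simp] theorem laurentExpansionAt_C (t₀ : ℂ) (q : ℚ) :
    laurentExpansionAt t₀ (C q) = HahnSeries.C (q : ℂ) := by
  simp [laurentExpansionAt]

/-- `laurentExpansionAt t₀ t = t₀ + s`. [folklore] -/
@[simp] theorem laurentExpansionAt_X (t₀ : ℂ) :
    laurentExpansionAt t₀ X = HahnSeries.C t₀ + HahnSeries.single 1 1 := by
  simp [laurentExpansionAt]

/-- The Laurent expansion map factors as `taylor t₀ ∘ map (algebraMap ℚ ℂ)` followed by the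
coercions `ℂ[s] → ℂ⟦s⟧ → ℂ((s))`. [folklore] -/
theorem laurentExpansionAt_apply (t₀ : ℂ) (p : ℚ[X]) :
    laurentExpansionAt t₀ p =
      HahnSeries.ofPowerSeries ℤ ℂ
        (((p.map (algebraMap ℚ ℂ)).taylor t₀ : ℂ[X]) : PowerSeries ℂ) := by
  simp only [laurentExpansionAt, RingHom.coe_comp, Function.comp_apply,
    Polynomial.coeToPowerSeries.ringHom_apply, coe_eval₂RingHom]
  congr 2
  rw [taylor_apply, Polynomial.comp, eval₂_map]
  congr 1
  exact add_comm _ _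

/-- `laurentExpansionAt t₀` is injective. [folklore] -/
theorem laurentExpansionAt_injective (t₀ : ℂ) : Function.Injective (laurentExpansionAt t₀) := by
  intro p q hpq
  rw [laurentExpansionAt_apply, laurentExpansionAt_apply] at hpq
  have h1 := HahnSeries.ofPowerSeries_injective hpq
  have h2 : (p.map (algebraMap ℚ ℂ)).taylor t₀ = (q.map (algebraMap ℚ ℂ)).taylor t₀ :=
    Polynomial.coe_injective ℂ h1
  have h3 := Polynomial.taylor_injective t₀ h2
  exact Polynomial.map_injective _ (algebraMap ℚ ℂ).injective h3

/-- The `Fin 1 → ℝ` phrasing used by route `DessinsDimensionOne` (item `BelyiNormalForm` quantifies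
over `x ∈ {x : Fin 1 → ℝ | x 0 ∈ (0,1)}` and evaluates at `x 0`): for `f : (Fin 1 → ℝ) → ℝ`,
`IsBelyiIntegrand (fun t ↦ f (fun _ ↦ t))` is literally the route's inlined conjunct. [folklore] -/
theorem isBelyiIntegrand_comp_const_iff (f : (Fin 1 → ℝ) → ℝ) :
    IsBelyiIntegrand (fun t => f (fun _ => t)) ↔
      ∃ P : Polynomial (Polynomial ℚ), P ≠ 0 ∧
        (∀ x ∈ {x : Fin 1 → ℝ | x 0 ∈ Set.Ioo (0:ℝ) 1},
          (P.map (Polynomial.mapRingHom (algebraMap ℚ ℝ))).evalEval (x 0) (f x) = 0) ∧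
        ∀ t₀ : ℂ, t₀ ≠ 0 → t₀ ≠ 1 →
          (P.map ((HahnSeries.ofPowerSeries ℤ ℂ).comp
            ((Polynomial.coeToPowerSeries.ringHom (R := ℂ)).comp
              (Polynomial.eval₂RingHom (algebraMap ℚ (Polynomial ℂ))
                (Polynomial.C t₀ + Polynomial.X))))).Splits := by
  have hx : ∀ x : Fin 1 → ℝ, (fun _ => x 0) = x := fun x => funext fun i => by
    rw [Subsingleton.elim i 0]
  refine exists_congr fun P => and_congr_right fun _ => and_congr_left fun _ => ?_
  constructor
  · intro H x hx0
    simpa [hx x] using H (x 0) hx0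
  · intro H t ht
    exact H (fun _ => t) ht

/-! ### Auxiliary algebra -/

/-- `evalEval` after the substitution `t ↦ g(t)` in the coefficient variable. [folklore] -/
theorem evalEval_map_compRingHom {R : Type*} [CommSemiring R] (g : R[X]) (x y : R)
    (Q : R[X][X]) :
    (Q.map (compRingHom g : R[X] →+* R[X])).evalEval x y = Q.evalEval (g.eval x) y := by
  have key : (evalEvalRingHom x y).comp (mapRingHom (compRingHom g : R[X] →+* R[X])) =
      evalEvalRingHom (g.eval x) y := by
    apply Polynomial.ringHom_ext
    · intro a
      simp [eval_comp]
    · simp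
  exact congrArg (fun φ : R[X][X] →+* R => φ Q) key

/-- `evalEval x y` only depends on the value at `x` of the substituted coefficient:
`eval x (Q.eval Z) = Q.evalEval x (Z.eval x)`. [folklore] -/
theorem eval_eval_eq_evalEval {R : Type*} [CommSemiring R] (x : R) (Z : R[X]) (Q : R[X][X]) :
    (Q.eval Z).eval x = Q.evalEval x (Z.eval x) := by
  rw [← coe_evalRingHom, ← eval₂_id (p := Q) (x := Z), hom_eval₂, ← eval₂_evalRingHom]
  simp

/-- `PowerSeries.rescale (-1)` (the substitution `s ↦ -s`) is an involution of `ℂ⟦s⟧`, hence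
injective. [folklore] -/
theorem rescale_neg_one_injective :
    Function.Injective (PowerSeries.rescale (-1 : ℂ)) := by
  intro f g hfg
  have := congrArg (PowerSeries.rescale (-1 : ℂ)) hfg
  simpa [PowerSeries.rescale_rescale, PowerSeries.rescale_one] using this

/-- The substitution `s ↦ -s` on the Laurent-series field `ℂ((s))`: the extension of
`PowerSeries.rescale (-1)` through the fraction field `ℂ((s)) = Frac ℂ⟦s⟧`. [folklore] -/
def laurentNeg : LaurentSeries ℂ →+* LaurentSeries ℂ :=
  IsFractionRing.map (A := PowerSeries ℂ) (B := PowerSeries ℂ) (K := LaurentSeries ℂ)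
    (L := LaurentSeries ℂ) rescale_neg_one_injective

/-- `laurentNeg` extends `PowerSeries.rescale (-1)`. [folklore] -/
theorem laurentNeg_ofPowerSeries (f : PowerSeries ℂ) :
    laurentNeg (HahnSeries.ofPowerSeries ℤ ℂ f) =
      HahnSeries.ofPowerSeries ℤ ℂ (PowerSeries.rescale (-1 : ℂ) f) := by
  have := IsLocalization.map_eq (S := LaurentSeries ℂ) (Q := LaurentSeries ℂ)
    (M := nonZeroDivisors (PowerSeries ℂ)) (T := nonZeroDivisors (PowerSeries ℂ))
    (nonZeroDivisors_le_comap_nonZeroDivisors_of_injective _ rescale_neg_one_injective) f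
  simpa [laurentNeg, IsFractionRing.map, LaurentSeries.coe_algebraMap] using this

/-- `PowerSeries.rescale` fixes constants. [folklore] -/
theorem rescale_C' (a r : ℂ) : PowerSeries.rescale a (PowerSeries.C r) = PowerSeries.C r := by
  ext n
  rw [PowerSeries.coeff_rescale, PowerSeries.coeff_C]
  split_ifs with h
  · simp [h]
  · simp

/-- The Laurent expansion at `t₀` of `p(1 - t)` is the image under `s ↦ -s` of the Laurent
expansion of `p` at `1 - t₀`. [folklore] -/
theorem laurentExpansionAt_comp_compRingHom_one_sub (t₀ : ℂ) :
    (laurentExpansionAt t₀).comp (compRingHom (1 - X) : ℚ[X] →+* ℚ[X]) =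
      laurentNeg.comp (laurentExpansionAt (1 - t₀)) := by
  have hX : ∀ t₁ : ℂ, laurentExpansionAt t₁ X =
      HahnSeries.ofPowerSeries ℤ ℂ (PowerSeries.C t₁ + PowerSeries.X) := fun t₁ => by
    simp [laurentExpansionAt]
  apply Polynomial.ringHom_ext
  · intro a
    simp only [RingHom.coe_comp, Function.comp_apply, coe_compRingHom, C_comp,
      laurentExpansionAt_C]
    rw [← HahnSeries.ofPowerSeries_C, laurentNeg_ofPowerSeries, rescale_C']
  · simp only [RingHom.coe_comp, Function.comp_apply, coe_compRingHom, X_comp, map_sub,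
      map_one, hX, laurentNeg_ofPowerSeries, map_add, rescale_C', PowerSeries.rescale_neg_one_X,
      map_neg]
    ring

namespace IsBelyiIntegrand

variable {h g : ℝ → ℝ}

/-- Being a Belyi integrand only depends on the values on `(0,1)`. [folklore] -/
theorem congr (hh : IsBelyiIntegrand h) (hg : Set.EqOn g h (Set.Ioo 0 1)) :
    IsBelyiIntegrand g := by
  obtain ⟨P, hP0, hP, hs⟩ := hh
  exact ⟨P, hP0, fun t ht => by rw [hg ht]; exact hP t ht, hs⟩

/-- **Genus zero.** A real function which on `(0,1)` satisfies `q(t) · h(t) = p(t)` for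
polynomials `p, q ∈ ℚ[t]`, `q ≠ 0`, is a Belyi integrand: `P = q(t) Y - p(t)` has degree one in
`Y`.  In particular every rational function `p/q ∈ ℚ(t)` without poles in `(0,1)` qualifies — and,
applying the lemma to `q p` and `q²`, so does any `h` agreeing with `p/q` off the zeros of `q`
(poles inside `(0,1)` are allowed, the values of `h` there are irrelevant). [folklore] -/
theorem of_mul_eq_polynomial (p q : ℚ[X]) (hq : q ≠ 0)
    (H : ∀ t ∈ Set.Ioo (0:ℝ) 1, aeval t q * h t = aeval t p) : IsBelyiIntegrand h := by
  refine ⟨C q * X - C p, ?_, ?_, ?_⟩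
  · intro h0
    have := congrArg (fun P : ℚ[X][X] => P.coeff 1) h0
    simp [coeff_C] at this
    exact hq this
  · intro t ht
    have := H t ht
    rw [aeval_def, aeval_def, ← eval_map, ← eval_map] at this
    simp only [Polynomial.map_sub, Polynomial.map_mul, map_C, map_X, evalEval_sub, evalEval_mul,
      evalEval_C, evalEval_X, coe_mapRingHom]
    rw [this, sub_self]
  · intro t₀ _ _
    simp only [Polynomial.map_sub, Polynomial.map_mul, map_C, map_X]
    exact Splits.of_degree_le_one
      ((degree_sub_le _ _).trans (max_le (degree_C_mul_X_le _) (degree_C_le.trans zero_le_one)))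


/-- Polynomials over `ℚ` are Belyi integrands. [folklore] -/
theorem _root_.Literature.NumberTheory.Transcendental.isBelyiIntegrand_aeval (p : ℚ[X]) :
    IsBelyiIntegrand (fun t => aeval t p) :=
  of_mul_eq_polynomial p 1 one_ne_zero fun t _ => by simp

/-- Rational constants are Belyi integrands. [folklore] -/
theorem _root_.Literature.NumberTheory.Transcendental.isBelyiIntegrand_const (c : ℚ) :
    IsBelyiIntegrand (fun _ => (c : ℝ)) :=
  (isBelyiIntegrand_aeval (C c)).congr fun t _ => by simp

/-- **Symmetry `t ↦ 1 - t`** (the Belyi-monoid involution exchanging the cusps `0` and `1`):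
if `h` is a Belyi integrand then so is `t ↦ h (1 - t)`; the new polynomial is `P(1 - t, Y)`.
[folklore] -/
theorem comp_one_sub (hh : IsBelyiIntegrand h) : IsBelyiIntegrand (fun t => h (1 - t)) := by
  rw [isBelyiIntegrand_iff] at hh ⊢
  obtain ⟨P, hP0, hP, hs⟩ := hh
  have hinv : (compRingHom (1 - X) : ℚ[X] →+* ℚ[X]).comp (compRingHom (1 - X)) =
      RingHom.id _ := by
    apply Polynomial.ringHom_ext
    · intro a
      simp
    · simp [sub_sub_cancel]
  refine ⟨P.map (compRingHom (1 - X) : ℚ[X] →+* ℚ[X]), ?_, ?_, ?_⟩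
  · intro h0
    apply hP0
    have := congrArg (Polynomial.map (compRingHom (1 - X) : ℚ[X] →+* ℚ[X])) h0
    rwa [Polynomial.map_map, hinv, Polynomial.map_id, Polynomial.map_zero] at this
  · intro t ht
    have ht' : 1 - t ∈ Set.Ioo (0:ℝ) 1 := ⟨by linarith [ht.2], by linarith [ht.1]⟩
    have hcomm : (mapRingHom (algebraMap ℚ ℝ)).comp (compRingHom (1 - X) : ℚ[X] →+* ℚ[X]) =
        (compRingHom (1 - X) : ℝ[X] →+* ℝ[X]).comp (mapRingHom (algebraMap ℚ ℝ)) := by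
      apply Polynomial.ringHom_ext
      · intro a
        simp
      · simp [Polynomial.map_sub]
    rw [Polynomial.map_map, hcomm, ← Polynomial.map_map, evalEval_map_compRingHom]
    simpa using hP (1 - t) ht'
  · intro t₀ h0 h1
    rw [Polynomial.map_map, laurentExpansionAt_comp_compRingHom_one_sub, ← Polynomial.map_map]
    refine (hs (1 - t₀) (sub_ne_zero.mpr (Ne.symm h1)) ?_).map _
    intro h
    exact h0 (by simpa using h)

/-- **Multiplication by a polynomial.** If `h` is a Belyi integrand and `p ∈ ℚ[t]`, then
`p · h` is one: the new polynomial is `scaleRoots P p = p^K P(t, Y/p)`. [folklore] -/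
theorem polynomial_mul (hh : IsBelyiIntegrand h) (p : ℚ[X]) :
    IsBelyiIntegrand (fun t => aeval t p * h t) := by
  rw [isBelyiIntegrand_iff] at hh ⊢
  obtain ⟨P, hP0, hP, hs⟩ := hh
  refine ⟨P.scaleRoots p, scaleRoots_ne_zero hP0 p, ?_, ?_⟩
  · intro t ht
    have hlc : (mapRingHom (algebraMap ℚ ℝ)) P.leadingCoeff ≠ 0 := by
      rw [coe_mapRingHom, Ne, Polynomial.map_eq_zero_iff (algebraMap ℚ ℝ).injective]
      exact leadingCoeff_ne_zero.mpr hP0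
    rw [map_scaleRoots _ _ _ hlc, ← coe_evalEvalRingHom, evalEvalRingHom_eq, coe_eval₂RingHom,
      show aeval t p = evalRingHom t (mapRingHom (algebraMap ℚ ℝ) p) by
        simp [aeval_def, eval_map],
      scaleRoots_eval₂_mul, eval₂_evalRingHom, hP t ht, mul_zero]
  · intro t₀ h0 h1
    have hlc : laurentExpansionAt t₀ P.leadingCoeff ≠ 0 :=
      ((laurentExpansionAt_injective t₀).ne_iff' (map_zero _)).mpr (leadingCoeff_ne_zero.mpr hP0)
    rw [map_scaleRoots _ _ _ hlc]
    exact (hs t₀ h0 h1).scaleRoots _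

/-- **Division by a polynomial.** If `h` is a Belyi integrand and `q · g = h` on `(0,1)` for a
nonzero `q ∈ ℚ[t]`, then `g` is a Belyi integrand: the new polynomial is `P(t, q Y)`. [folklore] -/
theorem of_polynomial_mul_eq (hh : IsBelyiIntegrand h) (q : ℚ[X]) (hq : q ≠ 0)
    (H : ∀ t ∈ Set.Ioo (0:ℝ) 1, aeval t q * g t = h t) : IsBelyiIntegrand g := by
  rw [isBelyiIntegrand_iff] at hh ⊢
  obtain ⟨P, hP0, hP, hs⟩ := hh
  refine ⟨P.comp (C q * X), ?_, ?_, ?_⟩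
  · intro h0
    rcases (comp_eq_zero_iff.mp h0) with h | ⟨-, h⟩
    · exact hP0 h
    · have := congrArg (fun r : ℚ[X][X] => r.coeff 1) h
      simp [coeff_C] at this
      exact hq this
  · intro t ht
    rw [map_comp, Polynomial.map_mul, map_C, map_X]
    unfold evalEval
    rw [eval_comp, eval_mul, eval_C, eval_X, eval_eval_eq_evalEval, eval_mul, eval_C,
      coe_mapRingHom, eval_map, ← aeval_def, H t ht]
    exact hP t ht
  · intro t₀ h0 h1
    rw [map_comp, Polynomial.map_mul, map_C, map_X]
    exact (hs t₀ h0 h1).comp_of_degree_le_one (degree_C_mul_X_le _)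

/-- **`ℚ(t)`-linearity.** If `h` is a Belyi integrand and `q · g = p · h` on `(0,1)` with
`p, q ∈ ℚ[t]`, `q ≠ 0` (i.e. `g = (p/q) h` away from the zeros of `q`), then `g` is a Belyi
integrand. [folklore] -/
theorem of_polynomial_mul_eq_polynomial_mul (hh : IsBelyiIntegrand h) (p q : ℚ[X]) (hq : q ≠ 0)
    (H : ∀ t ∈ Set.Ioo (0:ℝ) 1, aeval t q * g t = aeval t p * h t) : IsBelyiIntegrand g :=
  (hh.polynomial_mul p).of_polynomial_mul_eq q hq H

/-- Belyi integrands are stable under negation. [folklore] -/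
theorem neg (hh : IsBelyiIntegrand h) : IsBelyiIntegrand (fun t => -h t) :=
  (hh.polynomial_mul (-1)).congr fun t _ => by simp

/-- Belyi integrands are stable under multiplication by rational constants. [folklore] -/
theorem const_mul (hh : IsBelyiIntegrand h) (c : ℚ) : IsBelyiIntegrand (fun t => (c : ℝ) * h t) :=
  (hh.polynomial_mul (C c)).congr fun t _ => by simp

end IsBelyiIntegrand

/-! ### Beta integrands `t ^ a * (1 - t) ^ b` -/

/-- Hensel's lemma in the `X`-adically complete ring `ℂ⟦X⟧`: a power series with nonzero
constant coefficient is an `n`-th power for every `n ≠ 0`. [folklore] -/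
theorem exists_eq_pow_of_constantCoeff_ne_zero {n : ℕ} (hn : n ≠ 0) (u : PowerSeries ℂ)
    (hu : PowerSeries.constantCoeff u ≠ 0) : ∃ r : PowerSeries ℂ, u = r ^ n := by
  classical
  obtain ⟨ρ, hρ⟩ := IsAlgClosed.exists_pow_nat_eq (PowerSeries.constantCoeff u)
    (Nat.pos_of_ne_zero hn)
  have hρ0 : ρ ≠ 0 := by
    rintro rfl
    exact hu (by rw [← hρ, zero_pow hn])
  have hH := (IsAdicComplete.henselianRing (PowerSeries ℂ)
    (Ideal.span {PowerSeries.X})).is_henselian (Polynomial.X ^ n - Polynomial.C u)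
    (Polynomial.monic_X_pow_sub_C u hn) (PowerSeries.C ρ) ?_ ?_
  · obtain ⟨r, hr, -⟩ := hH
    refine ⟨r, ?_⟩
    have : r ^ n - u = 0 := by simpa [Polynomial.IsRoot] using hr
    exact (sub_eq_zero.mp this).symm
  · rw [Ideal.mem_span_singleton, PowerSeries.X_dvd_iff]
    simp [hρ]
  · refine IsUnit.map _ ?_
    rw [Polynomial.derivative_sub, Polynomial.derivative_C, sub_zero,
      Polynomial.derivative_X_pow, Polynomial.eval_mul, Polynomial.eval_pow, Polynomial.eval_X,
      PowerSeries.isUnit_iff_constantCoeff]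
    simp [hρ0, hn]

/-- `u Y^n - w = u (Y^n - w/u)` over a field. [folklore] -/
private theorem C_mul_X_pow_sub_C_eq {F : Type*} [Field F] {u : F} (hu : u ≠ 0) (w : F)
    (n : ℕ) : (C u * X ^ n - C w : F[X]) = C u * (X ^ n - C (w / u)) := by
  rw [mul_sub, ← C_mul]
  congr 2
  field_simp

/-- The beta family, normalised form: if `n ≠ 0` and `N + a n = e₁`, `N + b n = e₂` with
`N, e₁, e₂ ∈ ℕ`, then `t ↦ t ^ a (1 - t) ^ b` is a Belyi integrand, witnessed by
`P = t^N (1-t)^N · Y^n - t^{e₁} (1-t)^{e₂}`. [folklore] -/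
theorem isBelyiIntegrand_rpow_mul_rpow_of_eq {a b : ℝ} {n N e₁ e₂ : ℕ} (hn : n ≠ 0)
    (ha : (N : ℝ) + a * n = e₁) (hb : (N : ℝ) + b * n = e₂) :
    IsBelyiIntegrand (fun t => t ^ a * (1 - t) ^ b) := by
  classical
  rw [isBelyiIntegrand_iff]
  have h1X : (1 - X : ℚ[X]) ≠ 0 := by
    intro h0
    simpa using congrArg (eval 0) h0
  have hv₀ : (X ^ N * (1 - X) ^ N : ℚ[X]) ≠ 0 :=
    mul_ne_zero (pow_ne_zero _ X_ne_zero) (pow_ne_zero _ h1X)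
  refine ⟨C (X ^ N * (1 - X) ^ N) * X ^ n - C (X ^ e₁ * (1 - X) ^ e₂), ?_, ?_, ?_⟩
  · -- `P ≠ 0`: its coefficient of `Y ^ n` is `t^N (1-t)^N ≠ 0`
    intro h0
    have := congrArg (fun P : ℚ[X][X] => P.coeff n) h0
    simp only [coeff_sub, coeff_C_mul_X_pow, if_true, coeff_C, hn, if_false, sub_zero,
      coeff_zero] at this
    exact hv₀ this
  · -- the real identity on `(0,1)`
    intro t ht
    obtain ⟨ht0, ht1⟩ := ht
    have h1t : 0 < 1 - t := sub_pos.mpr ht1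
    simp only [Polynomial.map_sub, Polynomial.map_mul, Polynomial.map_pow, map_C, map_X,
      evalEval_sub, evalEval_mul, evalEval_pow, evalEval_C, evalEval_X, coe_mapRingHom,
      Polynomial.map_one, eval_mul, eval_pow, eval_sub, eval_one, eval_X]
    rw [sub_eq_zero]
    calc t ^ N * (1 - t) ^ N * (t ^ a * (1 - t) ^ b) ^ n
        = (t ^ (N : ℝ) * t ^ (a * n)) * ((1 - t) ^ (N : ℝ) * (1 - t) ^ (b * n)) := by
          rw [mul_pow, Real.rpow_mul_natCast ht0.le, Real.rpow_mul_natCast h1t.le,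
            Real.rpow_natCast, Real.rpow_natCast]
          ring
      _ = t ^ e₁ * (1 - t) ^ e₂ := by
          rw [← Real.rpow_add ht0, ← Real.rpow_add h1t, ha, hb, Real.rpow_natCast,
            Real.rpow_natCast]
  · -- unramified outside `{0, 1}`: `t₀ + s` and `1 - t₀ - s` are `n`-th powers in `ℂ⟦s⟧`
    intro t₀ h0 h1
    set ψ : PowerSeries ℂ →+* LaurentSeries ℂ := HahnSeries.ofPowerSeries ℤ ℂ with hψ
    set x : PowerSeries ℂ := PowerSeries.C t₀ + PowerSeries.X with hx
    have hx0 : PowerSeries.constantCoeff x ≠ 0 := by simpa [hx] using h0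
    have hy0 : PowerSeries.constantCoeff (1 - x) ≠ 0 := by
      simpa [hx, sub_eq_zero] using fun h => h1 h.symm
    obtain ⟨ρ₁, hρ₁⟩ := exists_eq_pow_of_constantCoeff_ne_zero hn x hx0
    obtain ⟨ρ₂, hρ₂⟩ := exists_eq_pow_of_constantCoeff_ne_zero hn (1 - x) hy0
    have hψ₁ : ψ ρ₁ ≠ 0 := by
      intro h
      have : ρ₁ = 0 := HahnSeries.ofPowerSeries_injective (h.trans (map_zero ψ).symm)
      apply hx0
      rw [hρ₁, this, zero_pow hn, map_zero]
    have hψ₂ : ψ ρ₂ ≠ 0 := by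
      intro h
      have : ρ₂ = 0 := HahnSeries.ofPowerSeries_injective (h.trans (map_zero ψ).symm)
      apply hy0
      rw [hρ₂, this, zero_pow hn, map_zero]
    have hφX : laurentExpansionAt t₀ X = ψ x := by
      simp [laurentExpansionAt, hψ, hx]
    have hφ1X : laurentExpansionAt t₀ (1 - X) = ψ (1 - x) := by
      rw [map_sub, map_one, hφX, map_sub, map_one]
    have hv : laurentExpansionAt t₀ (X ^ N * (1 - X) ^ N) = (ψ ρ₁ ^ N * ψ ρ₂ ^ N) ^ n := by
      rw [map_mul, map_pow, map_pow, hφ1X, hφX, hρ₂, hρ₁, map_pow, map_pow]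
      ring
    have hw : laurentExpansionAt t₀ (X ^ e₁ * (1 - X) ^ e₂) = (ψ ρ₁ ^ e₁ * ψ ρ₂ ^ e₂) ^ n := by
      rw [map_mul, map_pow, map_pow, hφ1X, hφX, hρ₂, hρ₁, map_pow, map_pow]
      ring
    have hα : ψ ρ₁ ^ N * ψ ρ₂ ^ N ≠ 0 := mul_ne_zero (pow_ne_zero _ hψ₁) (pow_ne_zero _ hψ₂)
    rw [Polynomial.map_sub, Polynomial.map_mul, Polynomial.map_pow, map_C, map_C, map_X, hv, hw,
      C_mul_X_pow_sub_C_eq (pow_ne_zero n hα), ← div_pow]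
    have hζ := (Complex.isPrimitiveRoot_exp n hn).map_of_injective
      (f := (HahnSeries.C : ℂ →+* LaurentSeries ℂ)) HahnSeries.C_injective
    exact (X_pow_sub_C_splits_of_isPrimitiveRoot hζ rfl).C_mul _

/-- **Beta integrands.** For all rational exponents `a, b`, the function `t ↦ t ^ a (1 - t) ^ b`
on `(0,1)` (real powers) is a Belyi integrand — the dessin triples behind the beta integrals
`B(a + 1, b + 1) = ∫₀¹ t ^ a (1 - t) ^ b dt` (integrability, i.e. `a, b > -1`, is not needed for
the algebraic statement). [folklore] -/
theorem isBelyiIntegrand_rpow_mul_rpow (a b : ℚ) :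
    IsBelyiIntegrand (fun t => t ^ (a : ℝ) * (1 - t) ^ (b : ℝ)) := by
  -- common denominator `n`, integer exponents `A = a n`, `B = b n`, shift `N = |A| + |B|`
  have hn : a.den * b.den ≠ 0 := mul_ne_zero a.den_nz b.den_nz
  have hA : ((a : ℝ) * (a.den * b.den : ℕ)) = (a.num * b.den : ℤ) := by
    have hd : (a.den : ℝ) ≠ 0 := by exact_mod_cast a.den_nz
    rw [Rat.cast_def a]
    push_cast
    field_simp
  have hB : ((b : ℝ) * (a.den * b.den : ℕ)) = (b.num * a.den : ℤ) := by
    have hd : (b.den : ℝ) ≠ 0 := by exact_mod_cast b.den_nz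
    rw [Rat.cast_def b]
    push_cast
    field_simp
  set A : ℤ := a.num * b.den with hA_def
  set B : ℤ := b.num * a.den with hB_def
  set N : ℕ := A.natAbs + B.natAbs with hN_def
  have hAN : 0 ≤ A + N := by omega
  have hBN : 0 ≤ B + N := by omega
  refine isBelyiIntegrand_rpow_mul_rpow_of_eq (N := N) (e₁ := (A + N).toNat) (e₂ := (B + N).toNat)
    hn ?_ ?_
  · rw [hA]
    have := Int.toNat_of_nonneg hAN
    exact_mod_cast
      (by rw [this]; push_cast; ring : (((A + ↑N).toNat : ℤ) : ℝ) = (N : ℝ) + (A : ℝ)).symm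
  · rw [hB]
    have := Int.toNat_of_nonneg hBN
    exact_mod_cast
      (by rw [this]; push_cast; ring : (((B + ↑N).toNat : ℤ) : ℝ) = (N : ℝ) + (B : ℝ)).symm

end Literature.NumberTheory.Transcendental
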